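import Mathlib.Analysis.Convex.Deriv
import Literature.MathematicalPhysics.QuantumLattice.ApproximatingHamiltonianProofs
import Literature.MathematicalPhysics.QuantumLattice.DuhamelEqualTimeBounds
import HarnessLib

/-!
# Crux `TwSeededEnsembleEquivalenceR` (stmt-HubbardSuperconductivity-15581), line `cold-floor-collapse` (slug `Sketch`),
# skeleton v8 (block two-phase pinning) — registered stub `stub_logPartitionCalculus`

Support file (`--supports stmt-HubbardSuperconductivity-15581`; sorry-free; no definition).
First/second μ-derivatives of log Z(T − μN), Duhamel ≤ variance, Falk–Bruch transfer (abstract).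

For Hermitian `T`, `N` and `β > 0`, with `H_μ = T − μN`, `F(μ) = log Re Z_β(H_μ)`:
* `F'(μ) = β Re⟨N⟩_{H_μ}` (Duhamel's derivative formula `d/dt tr e^{A+tY} = tr(Y e^{A+tY})`,
  `Matrix.hasDerivAt_re_trace_exp_add_smul`);
* `(β Re⟨N⟩_{H_μ})' = D(μ) = β² b(μ)` with the truncated Duhamel function
  `b = (N,N) − ⟨N⟩² = (N − ⟨N⟩, N − ⟨N⟩) ≥ 0` (the susceptibility formula
  `hasDerivAt_re_gibbsState_source` and `duhamel_sub_smul_one` of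
  `ApproximatingHamiltonianProofs.lean`), hence `F` is convex;
* `b ≤ Var N = ⟨N²⟩ − ⟨N⟩²` (`re_duhamel_conjTranspose_le`, DLS `b ≤ g`);
* `Var N ≤ b + ½√(β b c)`, `c = Re⟨[A,[H_μ,A]]⟩`, `A = N − ⟨N⟩` (Falk–Bruch, `falkBruch_sum_le_of_le`
  for the single centred observable; the double commutator of `A` is that of `N`).
-/

set_option linter.dupNamespace false

namespace Summit.HubbardSuperconductivity.HubbardSuperconductivity.Theorems.TwSeededEnsembleEquivalenceR.ColdFloorLine

open Matrix Finset Literature.MathematicalPhysics.QuantumLattice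
open scoped ComplexOrder Matrix.Norms.L2Operator

noncomputable section

/-! ### Helper lemmas (private, prefixed `lpc_`) -/

section Helpers

variable {m : Type*} [Fintype m] [DecidableEq m] {H A : Matrix m m ℂ}

/-- **`d/ds log Z(H − sA) = β Re⟨A⟩_{H − sA}`** for Hermitian `H`, `A` (nonempty index type):
Duhamel's derivative formula `d/dt Re tr e^{𝔄+tY} = Re tr(Y e^{𝔄+tY})` with `𝔄 = −βH`, `Y = βA`,
and the chain rule for `log`. [folklore] -/
private theorem lpc_hasDerivAt_log_partitionFn_source (hH : H.IsHermitian) (hA : A.IsHermitian)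
    [Nonempty m] (β s : ℝ) :
    HasDerivAt (fun t : ℝ => Real.log (partitionFn β (H - (t : ℂ) • A)).re)
      (β * (gibbsState β (H - (s : ℂ) • A) A).re) s := by
  set 𝔄 : Matrix m m ℂ := -(β : ℂ) • H with h𝔄
  set Y : Matrix m m ℂ := (β : ℂ) • A with hY
  set Z : ℝ → ℝ := fun t => (NormedSpace.exp (𝔄 + t • Y)).trace.re with hZdef
  have hHt : ∀ t : ℝ, (H - (t : ℂ) • A).IsHermitian := fun t => isHermitian_sub_smul hH hA t
  have hgW : ∀ t : ℝ, gibbsWeight β (H - (t : ℂ) • A) = NormedSpace.exp (𝔄 + t • Y) := fun t =>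
    gibbsWeight_sub_smul β H A t
  have hZt : ∀ t : ℝ, Z t = (partitionFn β (H - (t : ℂ) • A)).re := by
    intro t
    simp only [hZdef, partitionFn, hgW]
  have hZpos : ∀ t, 0 < Z t := fun t => by rw [hZt]; exact partitionFn_re_pos (hHt t) β
  have hZ' : HasDerivAt Z ((Y * NormedSpace.exp (𝔄 + s • Y)).trace.re) s :=
    hasDerivAt_re_trace_exp_add_smul 𝔄 Y s
  have hfun : (fun t : ℝ => Real.log (partitionFn β (H - (t : ℂ) • A)).re) =
      fun t => Real.log (Z t) := by
    funext t
    rw [hZt]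
  rw [hfun]
  refine (hZ'.log (hZpos s).ne').congr_deriv ?_
  rw [hZt s, (hHt s).re_gibbsState β A, (hHt s).partitionFn_eq_ofReal, Complex.ofReal_re,
    ← hgW s, hY, Matrix.smul_mul, trace_smul, smul_eq_mul, Complex.re_ofReal_mul,
    trace_mul_comm A (gibbsWeight β (H - (s : ℂ) • A)), div_eq_mul_inv]
  ring

/-- The double commutator of a centred observable: `[A − c, [K, A − c]] = [A, [K, A]]`, written as
`(A − c)(K(A − c) − (A − c)K) − (K(A − c) − (A − c)K)(A − c) = A(KA − AK) − (KA − AK)A`. [folklore] -/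
private theorem lpc_doubleComm_sub_smul_one (K B : Matrix m m ℂ) (c : ℂ) :
    (B - c • (1 : Matrix m m ℂ)) * (K * (B - c • 1) - (B - c • 1) * K) -
        (K * (B - c • 1) - (B - c • 1) * K) * (B - c • 1) =
      B * (K * B - B * K) - (K * B - B * K) * B := by
  simp only [Matrix.sub_mul, Matrix.mul_sub, Matrix.smul_mul, Matrix.mul_smul, Matrix.one_mul,
    Matrix.mul_one, Matrix.mul_assoc]
  module

/-- **The truncated Duhamel function**: `Re (A − ⟨A⟩, A − ⟨A⟩) = Re (A, A) − (Re⟨A⟩)²` for Hermitian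
`H`, `A` (`⟨A⟩` is real; bilinearity `(A − c, A − c) = (A,A) − 2c⟨A⟩ + c²`). [folklore] -/
private theorem lpc_re_duhamel_centred (hH : H.IsHermitian) (hA : A.IsHermitian) [Nonempty m]
    (β : ℝ) :
    (duhamel β H (A - ((gibbsState β H A).re : ℂ) • 1) (A - ((gibbsState β H A).re : ℂ) • 1)).re =
      (duhamel β H A A).re - (gibbsState β H A).re ^ 2 := by
  set m₀ : ℝ := (gibbsState β H A).re with hm₀
  have hAm : gibbsState β H A = (m₀ : ℂ) := gibbsState_eq_re hH β hA
  rw [duhamel_sub_smul_one hH β A (m₀ : ℂ), hAm]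
  have e : duhamel β H A A - 2 * (m₀ : ℂ) * (m₀ : ℂ) + (m₀ : ℂ) ^ 2 =
      duhamel β H A A - ((m₀ ^ 2 : ℝ) : ℂ) := by
    push_cast
    ring
  rw [e, Complex.sub_re, Complex.ofReal_re]

/-- **The variance as the second moment of the centred observable**:
`Re⟨(A − ⟨A⟩)²⟩ = Re⟨A²⟩ − (Re⟨A⟩)²` for Hermitian `H`, `A` (`⟨1⟩ = 1`, `⟨A⟩` real). [folklore] -/
private theorem lpc_re_gibbsState_centred_sq (hH : H.IsHermitian) (hA : A.IsHermitian) [Nonempty m]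
    (β : ℝ) :
    (gibbsState β H ((A - ((gibbsState β H A).re : ℂ) • 1) * (A - ((gibbsState β H A).re : ℂ) • 1))).re =
      (gibbsState β H (A * A)).re - (gibbsState β H A).re ^ 2 := by
  set m₀ : ℝ := (gibbsState β H A).re with hm₀
  have hAm : gibbsState β H A = (m₀ : ℂ) := gibbsState_eq_re hH β hA
  have hZ : partitionFn β H ≠ 0 := by
    rw [partitionFn_eq_re hH β, Ne, Complex.ofReal_eq_zero]
    exact (partitionFn_re_pos hH β).ne'
  have h1 : gibbsState β H 1 = 1 := gibbsState_one β H hZ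
  have expand : (A - (m₀ : ℂ) • (1 : Matrix m m ℂ)) * (A - (m₀ : ℂ) • 1) =
      A * A - (2 * (m₀ : ℂ)) • A + ((m₀ : ℂ) ^ 2) • (1 : Matrix m m ℂ) := by
    simp only [Matrix.sub_mul, Matrix.mul_sub, Matrix.smul_mul, Matrix.mul_smul, Matrix.one_mul,
      Matrix.mul_one]
    module
  rw [expand, map_add, map_sub, map_smul, map_smul, h1, hAm, smul_eq_mul, smul_eq_mul, mul_one]
  have e : gibbsState β H (A * A) - 2 * (m₀ : ℂ) * (m₀ : ℂ) + (m₀ : ℂ) ^ 2 =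
      gibbsState β H (A * A) - ((m₀ ^ 2 : ℝ) : ℂ) := by
    push_cast
    ring
  rw [e, Complex.sub_re, Complex.ofReal_re]

/-- **Truncated Duhamel ≤ variance ≤ Falk–Bruch bound.** For Hermitian `H`, `A`, `β > 0`, with
`b = Re (A,A) − (Re⟨A⟩)²` (truncated Duhamel function), `g = Re⟨A²⟩ − (Re⟨A⟩)²` (variance) and
`c = Re⟨A(HA − AH) − (HA − AH)A⟩` (double commutator): `0 ≤ b ≤ g ≤ b + ½√(β b c)`
([DLS1978] Thm. 3.1 `b ≤ g`, and Thms. 3.1–3.2 / Falk–Bruch in the weak form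
`Matrix.falkBruch_sum_le_of_le`, both applied to the centred observable `A − ⟨A⟩`).
[cite: DLS1978, Thms. 3.1–3.2] -/
private theorem lpc_truncated_bounds (hH : H.IsHermitian) (hA : A.IsHermitian) [Nonempty m] {β : ℝ}
    (hβ : 0 < β) :
    0 ≤ (duhamel β H A A).re - (gibbsState β H A).re ^ 2 ∧
    (duhamel β H A A).re - (gibbsState β H A).re ^ 2 ≤
      (gibbsState β H (A * A)).re - (gibbsState β H A).re ^ 2 ∧
    (gibbsState β H (A * A)).re - (gibbsState β H A).re ^ 2 ≤
      ((duhamel β H A A).re - (gibbsState β H A).re ^ 2) +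
        1 / 2 * Real.sqrt (β * ((duhamel β H A A).re - (gibbsState β H A).re ^ 2) *
          (gibbsState β H (A * (H * A - A * H) - (H * A - A * H) * A)).re) := by
  have hb := lpc_re_duhamel_centred hH hA β
  have hg := lpc_re_gibbsState_centred_sq hH hA β
  set m₀ : ℝ := (gibbsState β H A).re with hm₀
  set B : Matrix m m ℂ := A - (m₀ : ℂ) • 1 with hB
  have hBh : B.IsHermitian := isHermitian_sub_smul hA isHermitian_one m₀
  have hdc : B * (H * B - B * H) - (H * B - B * H) * B = A * (H * A - A * H) - (H * A - A * H) * A :=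
    lpc_doubleComm_sub_smul_one H A _
  refine ⟨?_, ?_, ?_⟩
  · rw [← hb]
    exact hH.re_duhamel_self_nonneg hBh β
  · have h := re_duhamel_conjTranspose_le hH A β
    rw [hA.eq] at h
    linarith
  · have hFB := falkBruch_sum_le_of_le hH hβ.le (ι := Unit) (A := fun _ => B) (fun _ => hBh)
      (b₀ := (duhamel β H A A).re - m₀ ^ 2) (by rw [Fintype.sum_unique]; exact hb.le)
    simp only [Finset.univ_unique, Finset.sum_singleton] at hFB
    rw [hg, hdc] at hFB
    exact hFB

end Helpers

/-- (registered stub `stub_logPartitionCalculus` of skeleton v8; statement verbatim — see Lines/Sketch.lean for the docstring) -/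
theorem stub_logPartitionCalculus :
    ∀ (n : Type) [Fintype n] [DecidableEq n] [Nonempty n] (T Nop : Matrix n n ℂ), T.IsHermitian → Nop.IsHermitian →
      ∀ (β : ℝ), 0 < β →
        (∀ μ : ℝ, HasDerivAt (fun μ' : ℝ => Real.log (Matrix.partitionFn β (T - (μ' : ℂ) • Nop)).re)
            (β * (Matrix.gibbsState β (T - (μ : ℂ) • Nop) Nop).re) μ) ∧
        ConvexOn ℝ Set.univ (fun μ' : ℝ => Real.log (Matrix.partitionFn β (T - (μ' : ℂ) • Nop)).re) ∧
        (∀ μ : ℝ, ∃ D : ℝ,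
          HasDerivAt (fun μ' : ℝ => β * (Matrix.gibbsState β (T - (μ' : ℂ) • Nop) Nop).re) D μ ∧ 0 ≤ D ∧
          D ≤ β ^ 2 * ((Matrix.gibbsState β (T - (μ : ℂ) • Nop) (Nop * Nop)).re -
                (Matrix.gibbsState β (T - (μ : ℂ) • Nop) Nop).re ^ 2) ∧
          (Matrix.gibbsState β (T - (μ : ℂ) • Nop) (Nop * Nop)).re - (Matrix.gibbsState β (T - (μ : ℂ) • Nop) Nop).re ^ 2 ≤
            D / β ^ 2 + 1 / 2 * Real.sqrt (β * (D / β ^ 2) *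
              (Matrix.gibbsState β (T - (μ : ℂ) • Nop)
                (Nop * ((T - (μ : ℂ) • Nop) * Nop - Nop * (T - (μ : ℂ) • Nop)) - ((T - (μ : ℂ) • Nop) * Nop - Nop * (T - (μ : ℂ) • Nop)) * Nop)).re)) := by
  intro n _ _ _ T Nop hT hN β hβ
  -- `F' = β Re⟨N⟩`
  have hF : ∀ μ : ℝ, HasDerivAt (fun μ' : ℝ => Real.log (partitionFn β (T - (μ' : ℂ) • Nop)).re)
      (β * (gibbsState β (T - (μ : ℂ) • Nop) Nop).re) μ := fun μ =>
    lpc_hasDerivAt_log_partitionFn_source hT hN β μ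
  -- `(β Re⟨N⟩)' = β² × (truncated Duhamel function)`
  have hf : ∀ μ : ℝ, HasDerivAt (fun μ' : ℝ => β * (gibbsState β (T - (μ' : ℂ) • Nop) Nop).re)
      (β ^ 2 * ((duhamel β (T - (μ : ℂ) • Nop) Nop Nop).re -
        (gibbsState β (T - (μ : ℂ) • Nop) Nop).re ^ 2)) μ := fun μ =>
    ((hasDerivAt_re_gibbsState_source hT hN hβ μ).const_mul β).congr_deriv (by ring)
  -- `0 ≤ b ≤ g ≤ b + ½√(β b c)` at every `μ`
  have hbd := fun μ : ℝ => lpc_truncated_bounds (isHermitian_sub_smul hT hN μ) hN hβ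
  refine ⟨hF, ?_, fun μ => ?_⟩
  · -- convexity: `F'` is differentiable with non-negative derivative, hence monotone
    have hdF : deriv (fun μ' : ℝ => Real.log (partitionFn β (T - (μ' : ℂ) • Nop)).re) =
        fun μ : ℝ => β * (gibbsState β (T - (μ : ℂ) • Nop) Nop).re :=
      funext fun μ => (hF μ).deriv
    refine Monotone.convexOn_univ_of_deriv (fun μ => (hF μ).differentiableAt) ?_
    rw [hdF]
    refine monotone_of_deriv_nonneg (fun μ => (hf μ).differentiableAt) fun μ => ?_
    rw [(hf μ).deriv]
    exact mul_nonneg (sq_nonneg β) (hbd μ).1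
  · obtain ⟨h0, h1, h2⟩ := hbd μ
    refine ⟨_, hf μ, mul_nonneg (sq_nonneg β) h0, mul_le_mul_of_nonneg_left h1 (sq_nonneg β), ?_⟩
    rw [mul_div_cancel_left₀ _ (pow_ne_zero 2 hβ.ne')]
    exact h2

end

end Summit.HubbardSuperconductivity.HubbardSuperconductivity.Theorems.TwSeededEnsembleEquivalenceR.ColdFloorLine
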